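import Literature.ModelTheory.ProofTheory.LiftAtCodes
import Literature.ModelTheory.ExponentialFields.DefinableCompleteness
import Literature.ModelTheory.ExponentialFields.DecidableTheoryProofs
import Literature.ModelTheory.ExponentialFields.OrderedExpFieldModels
import HarnessLib

/-!
# The definable completeness scheme `[DC]` is a recursive set of sentences

Topic `Literature/ModelTheory/ExponentialFields`.  Fornasiero–Servi, *Definably complete Baire
structures*, Fund. Math. 209 (2010), Remark 2.10, on the axioms of definably complete (Baire)
structures: "The fact … can be expressed by a set of first-order sentences … If moreover the
language is recursive, this set of sentences is also recursive."  This file proves that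
statement for the scheme `[DC]` of `DefinableCompleteness.lean`
(`Literature.ModelTheory.ExponentialFields.DefinableCompleteness.scheme`), for Mathlib's concrete
Gödel numbering (`Sentence.godelNumber`, `DecidableTheory.lean`) and the tree's notion
`Theory.IsRecursive` ("membership in the set of axioms is decidable on Gödel numbers"):

* `DefinableCompleteness.formulaLetters_sentence` — the letters of the instance `sentence φ` as
  an explicit primitive recursive function `dcLetters` of `m` and the letters of `φ` (through
  `formulaLetters_liftAt` of `ProofTheory/LiftAtCodes.lean`);
* `dcLettersB` — the recogniser of the letter strings of the instances (the letters of `φ` are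
  read off by the recursive-descent recogniser `parseF` of `ProofTheory/SentenceCodes.lean`, then
  the string is compared with `dcLetters`), `dcLettersB_iff` (correctness), `primrec_dcLettersB`
  (primitive recursive relative to arity tables), `computable_dcLettersB`;
* **`DefinableCompleteness.isRecursive_scheme`**: `[DC]` is recursive for every language with
  computable arity tables, in particular (`isRecursive_scheme_orderedExpRing`) for the language
  `(+, *, -, 0, 1, exp, ≤)` of `ℝ_exp`;
* the consequence for the programme of `MacintyreWilkie.lean`
  (`macintyreWilkie_recursiveSubtheory`: a recursive `T₀ ⊆ Th(ℝ_exp)` axiomatizing it modulo the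
  existential theory): **`exists_recursive_subtheory_definablyComplete`** — `OEF ∪ [DC]` is a
  recursive set of axioms of `T_exp` whose models are exactly what the modern route to that
  theorem starts from, definably complete ordered exponential fields (Jones–Servi 2011,
  Def. 1.2: "[OF] …; [DCB] Axioms of definably complete Baire structure; …  Notice that `T` is
  recursive").  This is bookkeeping towards that named fact, not a proof of it.

Everything is proved; no named facts.

## References

* A. Fornasiero, T. Servi, *Definably complete Baire structures*, Fund. Math. 209 (2010),
  Remark 2.10. [FornasieroServi2010]
* G. O. Jones, T. Servi, *On the decidability of the real field with a generic power function*,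
  J. Symbolic Logic 76 (2011), Def. 1.2. [JonesServi2011]
* H. B. Enderton, *A Mathematical Introduction to Logic*, 2nd ed. (2001), §3.4. [Enderton2001]
-/

open FirstOrder FirstOrder.Language Encodable Denumerable
open Literature.ModelTheory.ProofTheory.PreFOL

namespace Literature.ModelTheory.ExponentialFields

namespace DefinableCompleteness

/-! ### The letters of the instances of `[DC]` -/

/-- Letters of `upperBound φ` from the letters `w` of `φ` (`rLe` the code of `≤`, `m` the number
of parameters). [folklore] -/
def ubLetters (rLe m : ℕ) (w : List ℕ) : List ℕ :=
  7 :: 3 :: (liftLetters 1 m w ++ leLetters rLe (m + 2) (m + 1) m)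

/-- Letters of `leastUpperBound φ` from the letters `w` of `φ`. [folklore] -/
def lubLetters (rLe m : ℕ) (w : List ℕ) : List ℕ :=
  3 :: ((3 :: (ubLetters rLe m w ++ 3 ::
    ((7 :: 3 :: (liftLetters 1 m (ubLetters rLe m w) ++ leLetters rLe (m + 2) m (m + 1))) ++
      [4 * (m + 1) + 11]))) ++ [4 * (m + 1) + 11])

/-- Letters of `sentence φ` from `m` and the letters `w` of `φ`. [folklore] -/
def dcLetters (rLe m : ℕ) (w : List ℕ) : List ℕ :=
  List.replicate m 7 ++ 3 :: (exLetters m w ++ 3 ::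
    (exLetters m (ubLetters rLe m w) ++ exLetters m (lubLetters rLe m w)))

section Letters

variable {L : Language} [Encodable (Σ i, L.Functions i)] [Encodable (Σ i, L.Relations i)]
  [L.IsOrdered]

/-- The letters of `upperBound φ`. [folklore] -/
theorem formulaLetters_upperBound {m : ℕ} (φ : L.BoundedFormula Empty (m + 1)) :
    formulaLetters (upperBound φ) =
      ubLetters (encode (⟨2, leSymb⟩ : Σ n, L.Relations n)) m (formulaLetters φ) := by
  rw [upperBound, formulaLetters_all, formulaLetters_imp, formulaLetters_liftAt,
    formulaLetters_le_var]
  rfl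

/-- The letters of `leastUpperBound φ`. [folklore] -/
theorem formulaLetters_leastUpperBound {m : ℕ} (φ : L.BoundedFormula Empty (m + 1)) :
    formulaLetters (leastUpperBound φ) =
      lubLetters (encode (⟨2, leSymb⟩ : Σ n, L.Relations n)) m (formulaLetters φ) := by
  rw [leastUpperBound, formulaLetters_inf, formulaLetters_all, formulaLetters_imp,
    formulaLetters_liftAt, formulaLetters_upperBound, formulaLetters_le_var]
  rfl

/-- **The letters of the instance `sentence φ` of `[DC]`** are `dcLetters rLe m (formulaLetters φ)`.
[folklore] -/
theorem formulaLetters_sentence {m : ℕ} (φ : L.BoundedFormula Empty (m + 1)) :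
    formulaLetters (sentence φ) =
      dcLetters (encode (⟨2, leSymb⟩ : Σ n, L.Relations n)) m (formulaLetters φ) := by
  rw [sentence, formulaLetters_alls, formulaLetters_imp, formulaLetters_imp, formulaLetters_ex,
    formulaLetters_ex, formulaLetters_ex, formulaLetters_upperBound, formulaLetters_leastUpperBound]
  rfl

end Letters

/-! ### The recogniser of the letter strings of `[DC]` -/

/-- After the `m` leading `7`s and the four letters `3, 3, 7, 3`, the letters of `sentence φ`
continue with the letters of `φ`. [folklore] -/
theorem drop_dcLetters (rLe m : ℕ) (w : List ℕ) :
    (dcLetters rLe m w).drop (m + 4) =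
      w ++ ([4 * (m + 1) + 11, 4 * m + 11] ++ 3 ::
        (exLetters m (ubLetters rLe m w) ++ exLetters m (lubLetters rLe m w))) := by
  rw [dcLetters, ← List.drop_drop, List.drop_left' (List.length_replicate)]
  simp [exLetters]

/-- One candidate `m`: the letters after position `m + 4` begin with the letters `w` of a formula
at depth `m + 1` — found by the recursive-descent recogniser `parseF` of `SentenceCodes.lean`,
which returns the unread remainder — and `l` is exactly `dcLetters rLe m w`. [folklore] -/
def dcLettersStep (oF oR : ℕ → Option ℕ) (rLe m : ℕ) (l : List ℕ) : Bool :=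
  ((parseF oF oR l.length (m + 1) (l.drop (m + 4))).map fun rest =>
    decide (l = dcLetters rLe m ((l.drop (m + 4)).take ((l.drop (m + 4)).length - rest.length)))).getD
    false

/-- The recogniser of the letter strings of the instances of `[DC]`, relative to arity oracles
and the code `rLe` of `≤`: some `m ≤ |l|` works. [folklore] -/
def dcLettersB (oF oR : ℕ → Option ℕ) (rLe : ℕ) (l : List ℕ) : Bool :=
  decide (∃ m < l.length + 1, dcLettersStep oF oR rLe m l = true)

section Correct

variable {L : Language} [Encodable (Σ i, L.Functions i)] [Encodable (Σ i, L.Relations i)]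
  [L.IsOrdered]

/-- **Correctness of the recogniser**: it accepts exactly the letter strings of the instances
`sentence φ` of the definable completeness scheme. [folklore] -/
theorem dcLettersB_iff {l : List ℕ} :
    dcLettersB (arityF L) (arityR L) (encode (⟨2, leSymb⟩ : Σ n, L.Relations n)) l = true ↔
      ∃ (m : ℕ) (φ : L.BoundedFormula Empty (m + 1)), formulaLetters (sentence φ) = l := by
  rw [dcLettersB, decide_eq_true_eq]
  constructor
  · rintro ⟨m, -, hm⟩
    rw [dcLettersStep] at hm
    cases hp : parseF (arityF L) (arityR L) l.length (m + 1) (l.drop (m + 4)) with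
    | none => rw [hp] at hm; simp at hm
    | some rest =>
      rw [hp, Option.map_some, Option.getD_some, decide_eq_true_eq] at hm
      obtain ⟨φ, hφ⟩ := exists_boundedFormula_of_parseF _ _ _ _ hp
      refine ⟨m, φ, ?_⟩
      rw [formulaLetters_sentence, hm, hφ, List.length_append, Nat.add_sub_cancel, List.take_left']
      rfl
  · rintro ⟨m, φ, rfl⟩
    have hlen : m + (formulaLetters φ).length < (formulaLetters (sentence φ)).length := by
      rw [formulaLetters_sentence]
      simp [dcLetters, exLetters]
      omega
    refine ⟨m, by omega, ?_⟩
    rw [dcLettersStep, formulaLetters_sentence, drop_dcLetters,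
      parseF_formulaLetters φ _ _ (by rw [← formulaLetters_sentence]; omega), Option.map_some,
      Option.getD_some, decide_eq_true_eq, List.length_append, Nat.add_sub_cancel, List.take_left']
    rfl

end Correct

/-! ### The recogniser is primitive recursive relative to tables, and computable -/

section PrimrecRec

open Primrec

/-- `ubLetters` is primitive recursive in `(rLe, m, w)`. [folklore] -/
theorem primrec_ubLetters : Primrec fun q : ℕ × ℕ × List ℕ => ubLetters q.1 q.2.1 q.2.2 := by
  unfold ubLetters
  have hm : Primrec fun q : ℕ × ℕ × List ℕ => q.2.1 := fst.comp snd
  refine list_cons.comp (const 7) (list_cons.comp (const 3) (list_append.comp ?_ ?_))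
  · exact primrec_liftLetters.comp (Primrec.pair (Primrec.pair (const 1) hm) (snd.comp snd))
  · exact primrec_leLetters.comp (Primrec.pair fst (Primrec.pair (nat_add.comp hm (const 2))
      (Primrec.pair (nat_add.comp hm (const 1)) hm)))

/-- `lubLetters` is primitive recursive in `(rLe, m, w)`. [folklore] -/
theorem primrec_lubLetters : Primrec fun q : ℕ × ℕ × List ℕ => lubLetters q.1 q.2.1 q.2.2 := by
  unfold lubLetters
  have hm : Primrec fun q : ℕ × ℕ × List ℕ => q.2.1 := fst.comp snd
  have hf1 : Primrec fun q : ℕ × ℕ × List ℕ => [4 * (q.2.1 + 1) + 11] :=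
    list_cons.comp (nat_add.comp (nat_mul.comp (const 4) (nat_add.comp hm (const 1))) (const 11)) (const [])
  have hub := primrec_ubLetters
  have hle : Primrec fun q : ℕ × ℕ × List ℕ => leLetters q.1 (q.2.1 + 2) q.2.1 (q.2.1 + 1) :=
    primrec_leLetters.comp (Primrec.pair fst (Primrec.pair (nat_add.comp hm (const 2))
      (Primrec.pair hm (nat_add.comp hm (const 1)))))
  have hlift : Primrec fun q : ℕ × ℕ × List ℕ => liftLetters 1 q.2.1 (ubLetters q.1 q.2.1 q.2.2) :=
    primrec_liftLetters.comp (Primrec.pair (Primrec.pair (const 1) hm) hub)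
  exact list_cons.comp (const 3) (list_append.comp (list_cons.comp (const 3) (list_append.comp hub
    (list_cons.comp (const 3) (list_append.comp (list_cons.comp (const 7) (list_cons.comp (const 3)
      (list_append.comp hlift hle))) hf1)))) hf1)

/-- `dcLetters` is primitive recursive in `(rLe, m, w)`. [folklore] -/
theorem primrec_dcLetters : Primrec fun q : ℕ × ℕ × List ℕ => dcLetters q.1 q.2.1 q.2.2 := by
  unfold dcLetters
  have hm : Primrec fun q : ℕ × ℕ × List ℕ => q.2.1 := fst.comp snd
  have hrep : Primrec fun q : ℕ × ℕ × List ℕ => List.replicate q.2.1 7 :=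
    (list_map (list_range.comp hm) (const 7).to₂).of_eq fun q => by simp [List.map_const']
  have hex : Primrec fun q : ℕ × ℕ × List ℕ => exLetters q.2.1 q.2.2 := primrec_exLetters.comp snd
  have hexub : Primrec fun q : ℕ × ℕ × List ℕ => exLetters q.2.1 (ubLetters q.1 q.2.1 q.2.2) :=
    primrec_exLetters.comp (Primrec.pair hm primrec_ubLetters)
  have hexlub : Primrec fun q : ℕ × ℕ × List ℕ => exLetters q.2.1 (lubLetters q.1 q.2.1 q.2.2) :=
    primrec_exLetters.comp (Primrec.pair hm primrec_lubLetters)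
  exact list_append.comp hrep (list_cons.comp (const 3) (list_append.comp hex (list_cons.comp (const 3)
    (list_append.comp hexub hexlub))))

/-- Arguments of the table-relative recogniser: `(τF, τR, rLe, m, letters)`. [folklore] -/
abbrev DArg : Type := List (Option ℕ) × List (Option ℕ) × ℕ × ℕ × List ℕ

/-- The table-relative step as a unary function. [folklore] -/
def dStep (b : DArg) : Bool := dcLettersStep (tab b.1) (tab b.2.1) b.2.2.1 b.2.2.2.1 b.2.2.2.2

/-- `dStep` is primitive recursive (through `primrec_pF` of `SentenceCodes.lean`). [folklore] -/
theorem primrec_dStep : Primrec dStep := by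
  have hτF : Primrec fun b : DArg => b.1 := fst
  have hτR : Primrec fun b : DArg => b.2.1 := fst.comp snd
  have hr : Primrec fun b : DArg => b.2.2.1 := fst.comp (snd.comp snd)
  have hm : Primrec fun b : DArg => b.2.2.2.1 := fst.comp (snd.comp (snd.comp snd))
  have hl : Primrec fun b : DArg => b.2.2.2.2 := snd.comp (snd.comp (snd.comp snd))
  have hd : Primrec fun b : DArg => b.2.2.2.2.drop (b.2.2.2.1 + 4) :=
    list_drop.comp (nat_add.comp hm (const 4)) hl
  have hparse : Primrec fun b : DArg =>
      parseF (tab b.1) (tab b.2.1) b.2.2.2.2.length (b.2.2.2.1 + 1) (b.2.2.2.2.drop (b.2.2.2.1 + 4)) :=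
    primrec_pF.comp (Primrec.pair hτF (Primrec.pair hτR (Primrec.pair (list_length.comp hl)
      (Primrec.pair (nat_add.comp hm (const 1)) hd))))
  have hw : Primrec fun q : DArg × List ℕ =>
      (q.1.2.2.2.2.drop (q.1.2.2.2.1 + 4)).take ((q.1.2.2.2.2.drop (q.1.2.2.2.1 + 4)).length - q.2.length) :=
    list_take.comp (nat_sub.comp (list_length.comp (hd.comp fst)) (list_length.comp snd)) (hd.comp fst)
  have hdc : Primrec fun q : DArg × List ℕ => dcLetters q.1.2.2.1 q.1.2.2.2.1
      ((q.1.2.2.2.2.drop (q.1.2.2.2.1 + 4)).take ((q.1.2.2.2.2.drop (q.1.2.2.2.1 + 4)).length - q.2.length)) :=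
    primrec_dcLetters.comp (Primrec.pair (hr.comp fst) (Primrec.pair (hm.comp fst) hw))
  have hpred : PrimrecPred fun q : DArg × List ℕ => q.1.2.2.2.2 = dcLetters q.1.2.2.1 q.1.2.2.2.1
      ((q.1.2.2.2.2.drop (q.1.2.2.2.1 + 4)).take ((q.1.2.2.2.2.drop (q.1.2.2.2.1 + 4)).length - q.2.length)) :=
    PrimrecRel.comp (Primrec.eq (α := List ℕ)) (hl.comp fst) hdc
  have hbody : Primrec fun q : DArg × List ℕ =>
      decide (q.1.2.2.2.2 = dcLetters q.1.2.2.1 q.1.2.2.2.1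
        ((q.1.2.2.2.2.drop (q.1.2.2.2.1 + 4)).take
          ((q.1.2.2.2.2.drop (q.1.2.2.2.1 + 4)).length - q.2.length))) := hpred.decide
  exact ((option_getD.comp (option_map hparse hbody.to₂) (const false)).of_eq fun b => rfl)

/-- The table-relative recogniser is primitive recursive in `(τF, τR, rLe, letters)`. [folklore] -/
theorem primrec_dcLettersB :
    Primrec fun q : List (Option ℕ) × List (Option ℕ) × ℕ × List ℕ =>
      dcLettersB (tab q.1) (tab q.2.1) q.2.2.1 q.2.2.2 := by
  have hR : PrimrecRel fun (m : ℕ) (q : List (Option ℕ) × List (Option ℕ) × ℕ × List ℕ) =>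
      dStep (q.1, q.2.1, q.2.2.1, m, q.2.2.2) = true :=
    PrimrecRel.comp Primrec.eq (primrec_dStep.comp (Primrec.pair (fst.comp snd) (Primrec.pair
      (fst.comp (snd.comp snd)) (Primrec.pair (fst.comp (snd.comp (snd.comp snd))) (Primrec.pair fst
        (snd.comp (snd.comp (snd.comp snd)))))))) (const true)
  have h := (PrimrecRel.exists_mem_list hR).comp
    (list_range.comp (succ.comp (list_length.comp (snd.comp (snd.comp
      (snd (α := List (Option ℕ)) (β := List (Option ℕ) × ℕ × List ℕ)))))))
    (Primrec.id (α := List (Option ℕ) × List (Option ℕ) × ℕ × List ℕ))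
  refine (PrimrecPred.decide h).of_eq fun q => ?_
  rw [dcLettersB]
  refine decide_eq_decide.2 ?_
  simp [List.mem_range, dStep]

end PrimrecRec

section Congr

variable {oF oF' oR oR' : ℕ → Option ℕ} {B : ℕ}

/-- The step only consults the oracles below the letters. [folklore] -/
theorem dcLettersStep_congr (hoF : ∀ i < B, oF i = oF' i) (hoR : ∀ i < B, oR i = oR' i)
    (rLe m : ℕ) {l : List ℕ} (hl : ∀ x ∈ l, x < B) :
    dcLettersStep oF oR rLe m l = dcLettersStep oF' oR' rLe m l := by
  unfold dcLettersStep
  rw [parseF_congr hoF hoR _ _ _ fun x hx => hl x (List.drop_subset _ _ hx)]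

/-- The recogniser only consults the oracles below the letters. [folklore] -/
theorem dcLettersB_congr (hoF : ∀ i < B, oF i = oF' i) (hoR : ∀ i < B, oR i = oR' i)
    (rLe : ℕ) {l : List ℕ} (hl : ∀ x ∈ l, x < B) :
    dcLettersB oF oR rLe l = dcLettersB oF' oR' rLe l := by
  unfold dcLettersB
  simp only [dcLettersStep_congr hoF hoR rLe _ hl]

end Congr

section Decide

variable {L : Language} [Encodable (Σ i, L.Functions i)] [Encodable (Σ i, L.Relations i)]

omit [Encodable (Σ i, L.Functions i)] [Encodable (Σ i, L.Relations i)] in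
/-- **The recogniser with computable oracles is computable** (the oracles are tabulated below
the input, which bounds every symbol consulted; as `computable_sentenceLettersB`). [folklore] -/
theorem computable_dcLettersB {arF arR : ℕ → Option ℕ} (hF : Computable arF)
    (hR : Computable arR) (rLe : ℕ) :
    Computable fun n : ℕ => dcLettersB arF arR rLe (ofNat (List ℕ) n) := by
  have h1 : Computable fun n : ℕ => dcLettersB (tab (arityTable arF (n + 1)))
      (tab (arityTable arR (n + 1))) rLe (ofNat (List ℕ) n) :=
    primrec_dcLettersB.to_comp.comp (((computable_arityTable hF).comp Computable.succ).pair
      (((computable_arityTable hR).comp Computable.succ).pair ((Computable.const rLe).pair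
        (Computable.ofNat _))))
  refine h1.of_eq fun n => ?_
  exact dcLettersB_congr (B := n + 1) (fun i hi => tab_arityTable_of_lt hi)
    (fun i hi => tab_arityTable_of_lt hi) rLe (fun x hx => Nat.lt_succ_of_lt (lt_of_mem_ofNat hx))

variable [L.IsOrdered]

/-- **The set of Gödel numbers of the instances of `[DC]` is decidable**, for a language whose
arity tables are computable. [cite: FornasieroServi2010, Remark 2.10] -/
theorem computablePred_exists_sentence_godelNumber_eq (hF : Computable (arityF L))
    (hR : Computable (arityR L)) :
    ComputablePred fun n : ℕ =>
      ∃ (m : ℕ) (φ : L.BoundedFormula Empty (m + 1)), (sentence φ).godelNumber = n := by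
  refine ComputablePred.computable_iff.2 ⟨_, computable_dcLettersB hF hR
    (encode (⟨2, leSymb⟩ : Σ n, L.Relations n)), funext fun n => propext ?_⟩
  rw [dcLettersB_iff]
  constructor
  · rintro ⟨m, φ, h⟩
    exact ⟨m, φ, by rw [← h, godelNumber_eq, ofNat_encode]⟩
  · rintro ⟨m, φ, h⟩
    exact ⟨m, φ, by rw [godelNumber_eq, h, encode_ofNat]⟩

/-- **`[DC]` is a recursive set of sentences** for every language with computable arity tables
(Fornasiero–Servi 2010, Remark 2.10: "If moreover the language is recursive, this set of
sentences is also recursive"). [cite: FornasieroServi2010, Remark 2.10] -/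
theorem isRecursive_scheme (hF : Computable (arityF L)) (hR : Computable (arityR L)) :
    (scheme L).IsRecursive := by
  have h := computablePred_exists_sentence_godelNumber_eq hF hR
  unfold Theory.IsRecursive
  convert h using 2 with n
  simp only [scheme, Set.mem_setOf_eq]
  constructor
  · rintro ⟨σ, ⟨m, φ, rfl⟩, hσ⟩; exact ⟨m, φ, hσ⟩
  · rintro ⟨m, φ, h⟩; exact ⟨_, ⟨m, φ, rfl⟩, h⟩

/-- `[DC]` is recursive for every recursively presented ordered language. [cite: FornasieroServi2010, Remark 2.10] -/
theorem isRecursive_scheme_of_isRecursivelyPresented (hL : L.IsRecursivelyPresented) :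
    (scheme L).IsRecursive :=
  isRecursive_scheme hL.computable_arityF hL.computable_arityR

end Decide

/-- **`[DC]` in the language `(+, *, -, 0, 1, exp, ≤)` of `ℝ_exp` is a recursive set of
sentences.** [cite: FornasieroServi2010, Remark 2.10] -/
theorem isRecursive_scheme_orderedExpRing : (scheme Language.orderedExpRing).IsRecursive :=
  isRecursive_scheme_of_isRecursivelyPresented Language.orderedExpRing.isRecursivelyPresented

/-- `[DC]` in the language of ordered rings is a recursive set of sentences. [cite: FornasieroServi2010, Remark 2.10] -/
theorem isRecursive_scheme_orderedRing : (scheme Language.orderedRing).IsRecursive :=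
  isRecursive_scheme_of_isRecursivelyPresented Language.orderedRing.isRecursivelyPresented

end DefinableCompleteness

/-! ### A recursive subtheory of `T_exp` with definably complete models -/

/-- **`OEF ∪ [DC]` is a recursive set of true axioms of `T_exp` whose models are definably
complete** — the first two schemes `[OF]`, `[DCB]` (its definable-completeness half) of the
recursive subtheory `T` of Jones–Servi 2011, Def. 1.2 (the template, after Macintyre–Wilkie
1996, of a recursive `T₀ ⊆ Th(ℝ_exp)` as in `macintyreWilkie_recursiveSubtheory`), here with
the tree's finite true theory `Theory.OEF` of ordered exponential fields
(`OrderedExpFieldModels.lean`) for `[OF]`: there is a recursive `T₀ ⊆ Th(ℝ_exp)` containing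
`OEF` all of whose models (with `≤` read as their order) are definably complete.  Witness
`T₀ = OEF ∪ [DC]`; bookkeeping towards, not a proof of, `macintyreWilkie_recursiveSubtheory`.
[cite: JonesServi2011, Def. 1.2] -/
theorem exists_recursive_subtheory_definablyComplete :
    ∃ T₀ : Language.orderedExpRing.Theory, T₀ ⊆ realExpTheory ∧ T₀.IsRecursive ∧
      Theory.OEF ⊆ T₀ ∧
      ∀ (N : Type) [Language.orderedExpRing.Structure N] [LE N]
        [Language.orderedExpRing.OrderedStructure N], N ⊨ T₀ →
          Language.orderedExpRing.IsDefinablyComplete N :=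
  ⟨Theory.OEF ∪ DefinableCompleteness.scheme Language.orderedExpRing,
    Set.union_subset OEF_subset_realExpTheory DefinableCompleteness.scheme_subset_realExpTheory,
    OEF_isRecursive.union DefinableCompleteness.isRecursive_scheme_orderedExpRing,
    Set.subset_union_left, fun _ _ _ _ hN =>
      DefinableCompleteness.model_scheme_iff_isDefinablyComplete.1 (hN.mono Set.subset_union_right)⟩

end Literature.ModelTheory.ExponentialFields
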